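import Mathlib
import Summits.NavierStokesRegularity.NavierStokesRegularity.Theorems.EulerZoomLiouvillePowerGaugeEulerLiouvilleStretchingBudgetStarvation
import HarnessLib

/-!
# Crux `EulerZoomLiouville.PowerGaugeEulerLiouville` (stmt-NavierStokesRegularity-19832), line `stretching-budget` rev4, stub K2′:
# BUDGET STARVATION — GRADIENT-FREE (the landed K2 proof with its dead gradient-clause binder removed)

Route №10 `EulerZoomLiouville` (NavierStokesRegularity), crux E.  Line `stretching-budget` (ideator ns-idea-11 g4;
`Cruxes/PowerGaugeEulerLiouville/Lines/stretching_budget.lean` rev4 8cfa8ef277cf), stub **K2 `stub_budgetStarvation` in its GRADIENT-FREE text**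
(`IsDriftingPastWith` WITHOUT the clause «`∇u` bounded on compact time sets, uniformly in `x`»).  The rev1 text WITH the clause is LANDED:
`StretchingBudget.pastCurlFree_of_floorBlobsPersist` (ns-in-ser-c g2, p629500) — and, as the line owner recorded (rev4 docstring of
`stub_budgetStarvation`: «that proof never uses the gradient clause (its binder is the discarded `_hgrad`), so the upgrade is the same file with one
binder deleted»), its proof never touches the clause.  This file is exactly that: the statement with the clause conjunct deleted and the proof
of p629500 VERBATIM (credit: ns-in-ser-c g2; the real-variable helpers `window_length_le`, `rpow_le_of_floor_budget` are IMPORTED from that file,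
not restated).

THE ARGUMENT (unchanged; see p629500's docstring): blob by continuity of `curl u(t₀)`; for `a` large and `t₁` in the usable window
`(−L_a, t₀)`, `L_a = min(a², (c₁a)^{1/(1−κ)})`, the drift is `≤ a/4` (`CasimirFloor.drift_le_quarter`), the persistent-floor avatar sits in `B(0,a)`
with slice enstrophy `≥ V w² e^{−2Λ₁}((−t₀)/L_a)^{2K}`; the window integral against the `E`-gauge bound `CasimirFloor.lintegral_window_sq_curl_le`
gives `a^{γ(1−2K)−(1−ρ)} ≤ K₁` for all large `a`, absurd by the exponent race `K < min((1+ρ)/4, (κ+ρ−κρ)/2)`.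

* `pastCurlFree_of_floorBlobsPersist_free` — **K2′ = `Sig.stub_budgetStarvation` (rev4, gradient-free) with `InClass`, `IsDriftingPastWith`,
  `stretchingThreshold`, `HasStretchingBudget`, `FloorBlobsPersist`, `driftRadius` UNFOLDED VERBATIM.**

WHAT THIS IS NOT: not NS, not the crux — a helper `--supports` stmt-19832; with K1′ (`…StretchingBudgetFloorTransportFree`) it makes the
GRADIENT-FREE stratum `IsStretchingBudgeted` close by the line's own composition; the residue K3 `stub_budgetRest`, crux 19832 and NS regularity
stay OPEN.  [folklore]
-/

-- adapted from Theorems/EulerZoomLiouvillePowerGaugeEulerLiouvilleStretchingBudgetStarvation.lean (ns-in-ser-c g2, p629500): proof verbatim,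
-- one dead binder removed from the statement.

noncomputable section

-- flat `Theorems/<Route><Decl>…` files of one crux share the namespace of the crux (tree convention)
set_option linter.dupNamespace false

open MeasureTheory Set Filter Topology Metric Function
open scoped NNReal ENNReal RealInnerProductSpace

namespace Summit.NavierStokesRegularity.NavierStokesRegularity.Theorems.PowerGaugeEulerLiouville.StretchingBudget

open Literature.Analysis Literature.Analysis.FluidPDE
open Summit.NavierStokesRegularity.NavierStokesRegularity.Theorems.PowerGaugeEulerLiouville.CasimirFloor

/-- **K2′ `stub_budgetStarvation` of the line `stretching-budget`, GRADIENT-FREE, signature unfolded** (`∀ ρ ∈ (0, 1/2], ∀ (u,p,H,c) ∈ InClass ρ,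
∀ T₁ M κ K Λ, IsDriftingPastWith u p T₁ M κ → 0 ≤ K → K < stretchingThreshold ρ κ → HasStretchingBudget u T₁ K Λ →
FloorBlobsPersist u T₁ M κ K Λ → ∀ τ < T₁, curl u(τ) ≡ 0`, rev4 defs — NO gradient clause): GIVEN persistent floor blobs, a classical member
of the power-gauged class with a drifting far past and a sub-threshold stretching budget has an irrotational far past.  (Proof = p629500's,
ns-in-ser-c g2, verbatim.) [folklore] -/
theorem pastCurlFree_of_floorBlobsPersist_free :
    ∀ ρ : ℝ, 0 < ρ → ρ ≤ 1 / 2 →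
      ∀ (u : ℝ → EuclideanSpace ℝ (Fin 3) → EuclideanSpace ℝ (Fin 3)) (p : ℝ → EuclideanSpace ℝ (Fin 3) → ℝ)
        (H : ℝ → EuclideanSpace ℝ (Fin 3) → EuclideanSpace ℝ (Fin 3) →L[ℝ] EuclideanSpace ℝ (Fin 3)) (c : ℝ≥0),
        (IsSuitableWeakSolutionOn (slab (EuclideanSpace ℝ (Fin 3)) (Set.Iio 0) isOpen_Iio) 0 0 u p ∧
            HasWeakSpatialGradientOn (slab (EuclideanSpace ℝ (Fin 3)) (Set.Iio 0) isOpen_Iio) u H ∧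
            (∀ a : ℝ, 0 < a →
              ENNReal.ofReal (a ^ (2 * ρ)) * cknA a (0 : ℝ × EuclideanSpace ℝ (Fin 3)) u +
                    ENNReal.ofReal (a ^ ρ) * cknE a (0 : ℝ × EuclideanSpace ℝ (Fin 3)) H +
                  ENNReal.ofReal (a ^ (2 * ρ)) * cknD a (0 : ℝ × EuclideanSpace ℝ (Fin 3)) p ≤ (c : ℝ≥0∞))) →
          ∀ (T₁ M κ K : ℝ) (Λ : ℝ → ℝ),
            (IsClassicalEulerSolutionOn (Set.Iio 0) 0 u p ∧ T₁ ≤ 0 ∧ 0 ≤ M ∧ κ < 1 ∧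
                (∀ τ : ℝ, τ < T₁ → ∀ x : EuclideanSpace ℝ (Fin 3), ‖u τ x‖ ≤ M * (-τ) ^ (-κ))) →
              0 ≤ K → K < min ((1 + ρ) / 4) ((κ + ρ - κ * ρ) / 2) →
                (IntegrableOn Λ (Set.Iio T₁) ∧ (∀ τ : ℝ, 0 ≤ Λ τ) ∧
                    ∀ τ : ℝ, τ < T₁ → ∀ x : EuclideanSpace ℝ (Fin 3),
                      ⟪fderiv ℝ (u τ) x (curl (u τ) x), curl (u τ) x⟫ ≤ (K / (-τ) + Λ τ) * ‖curl (u τ) x‖ ^ 2) →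
                  (∀ t₀ : ℝ, t₀ < T₁ → ∀ (x₀ : EuclideanSpace ℝ (Fin 3)) (δ w : ℝ), 0 < δ → 0 ≤ w →
                      (∀ x ∈ ball x₀ δ, w ≤ ‖curl (u t₀) x‖) →
                        ∀ t₁ : ℝ, t₁ < t₀ →
                          ∃ T : Set (EuclideanSpace ℝ (Fin 3)), MeasurableSet T ∧
                            T ⊆ ball (0 : EuclideanSpace ℝ (Fin 3))
                              (‖x₀‖ + δ + M / (1 - κ) * ((-t₁) ^ (1 - κ) - (-t₀) ^ (1 - κ))) ∧
                            volume T = volume (ball x₀ δ) ∧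
                            ∀ x ∈ T,
                              w ^ 2 * Real.exp (-(2 * ∫ s in Set.Ioo t₁ t₀, Λ s)) * ((-t₀) / (-t₁)) ^ (2 * K) ≤
                                ‖curl (u t₁) x‖ ^ 2) →
                    ∀ τ : ℝ, τ < T₁ → ∀ x : EuclideanSpace ℝ (Fin 3), curl (u τ) x = 0 := by
  intro ρ _hρ hρ2 u p H c hcls T₁ M κ K Λ hD hK0 hK hB hblob
  obtain ⟨_hsw, hH, hgauge⟩ := hcls
  obtain ⟨hcl, hT₁, hM0, hκ1, _henv⟩ := hD
  obtain ⟨hΛi, hΛ0, _hstretch⟩ := hB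
  have hE : ∀ a : ℝ, 0 < a →
      ENNReal.ofReal (a ^ ρ) * cknE a (0 : ℝ × EuclideanSpace ℝ (Fin 3)) H ≤ (c : ℝ≥0∞) :=
    fun a ha => (le_add_self.trans le_self_add).trans (hgauge a ha)
  have hC1 : ∀ τ : ℝ, τ < 0 → ContDiff ℝ 1 (u τ) := fun τ hτ => (hcl.contDiff_velocity hτ).of_le (by norm_cast)
  intro t₀ ht₀T
  have ht₀ : t₀ < 0 := lt_of_lt_of_le ht₀T hT₁
  have hnt₀ : 0 < -t₀ := by linarith
  by_contra hne
  push Not at hne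
  obtain ⟨x₀, hx₀⟩ := hne
  -- a blob by continuity of the vorticity slice
  have hcont : Continuous (curl (u t₀)) := continuous_curl (hC1 t₀ ht₀)
  obtain ⟨w, hw⟩ : ∃ w : ℝ, w = ‖curl (u t₀) x₀‖ / 2 := ⟨_, rfl⟩
  have hw0 : 0 < w := by rw [hw]; exact half_pos (norm_pos_iff.2 hx₀)
  obtain ⟨δ, hδ, hball⟩ : ∃ δ : ℝ, 0 < δ ∧ ∀ x ∈ ball x₀ δ, w ≤ ‖curl (u t₀) x‖ := by
    obtain ⟨δ, hδ, hδball⟩ := Metric.continuousAt_iff.1 hcont.norm.continuousAt w hw0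
    refine ⟨δ, hδ, fun x hx => ?_⟩
    have h := hδball (mem_ball.1 hx)
    rw [Real.dist_eq, abs_lt] at h
    linarith [h.1]
  -- exponents: `2K < 1`, `e = (1-κ)⁻¹ > 0`, `γ = min 2 e > 0`, and the race `γ(1-2K) > 1-ρ`
  have h1κ : 0 < 1 - κ := by linarith
  have hKa : K < (1 + ρ) / 4 := lt_of_lt_of_le hK (min_le_left _ _)
  have hKb : K < (κ + ρ - κ * ρ) / 2 := lt_of_lt_of_le hK (min_le_right _ _)
  have h2K : 2 * K < 1 := by linarith
  obtain ⟨e, he⟩ : ∃ e : ℝ, e = (1 - κ)⁻¹ := ⟨_, rfl⟩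
  have he0 : 0 < e := by rw [he]; exact inv_pos.2 h1κ
  obtain ⟨γ, hγ⟩ : ∃ γ : ℝ, γ = min 2 e := ⟨_, rfl⟩
  have hγ2 : γ ≤ 2 := by rw [hγ]; exact min_le_left _ _
  have hγe : γ ≤ e := by rw [hγ]; exact min_le_right _ _
  have hγ0 : 0 < γ := by rw [hγ]; exact lt_min (by norm_num) he0
  have hrace : 1 - ρ < γ * (1 - 2 * K) := by
    rw [hγ, min_mul_of_nonneg _ _ (by linarith : (0 : ℝ) ≤ 1 - 2 * K)]
    refine lt_min (by linarith) ?_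
    rw [he, ← one_div, one_div_mul_eq_div, lt_div_iff₀ h1κ]
    nlinarith
  have hε0 : 0 < γ * (1 - 2 * K) - (1 - ρ) := by linarith
  -- constants
  obtain ⟨c₁, hc₁⟩ : ∃ c₁ : ℝ, c₁ = (1 - κ) / (4 * (M + 1)) := ⟨_, rfl⟩
  have hc₁0 : 0 < c₁ := by rw [hc₁]; positivity
  obtain ⟨c₂, hc₂⟩ : ∃ c₂ : ℝ, c₂ = min 1 (c₁ ^ e) := ⟨_, rfl⟩
  have hc₂0 : 0 < c₂ := by rw [hc₂]; exact lt_min one_pos (Real.rpow_pos_of_pos hc₁0 _)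
  have hc₂1 : c₂ ≤ 1 := by rw [hc₂]; exact min_le_left _ _
  have hc₂c : c₂ ≤ c₁ ^ e := by rw [hc₂]; exact min_le_right _ _
  obtain ⟨V, hV⟩ : ∃ V : ℝ, V = (volume (ball x₀ δ)).toReal := ⟨_, rfl⟩
  have hVtop : volume (ball x₀ δ) ≠ ⊤ := measure_ball_lt_top.ne
  have hV0 : 0 < V := by rw [hV]; exact ENNReal.toReal_pos (measure_ball_pos volume x₀ hδ).ne' hVtop
  have hVof : ENNReal.ofReal V = volume (ball x₀ δ) := by rw [hV, ENNReal.ofReal_toReal hVtop]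
  obtain ⟨Λ₁, hΛ₁⟩ : ∃ Λ₁ : ℝ, Λ₁ = ∫ s in Set.Iio T₁, Λ s := ⟨_, rfl⟩
  obtain ⟨C₀, hC₀⟩ : ∃ C₀ : ℝ, C₀ = V * (w ^ 2 * Real.exp (-(2 * Λ₁)) * (-t₀) ^ (2 * K)) := ⟨_, rfl⟩
  have hC₀0 : 0 < C₀ := by
    rw [hC₀]
    exact mul_pos hV0 (mul_pos (mul_pos (pow_pos hw0 2) (Real.exp_pos _)) (Real.rpow_pos_of_pos (by linarith) _))
  obtain ⟨K₁, hK₁⟩ : ∃ K₁ : ℝ, K₁ = 2 * (16 * (c : ℝ)) / (C₀ * c₂ ^ (1 - 2 * K)) := ⟨_, rfl⟩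
  -- a large radius `a`
  have hevγ : ∀ᶠ a : ℝ in atTop, 2 * (-t₀) / c₂ ≤ a ^ γ := (tendsto_rpow_atTop hγ0).eventually_ge_atTop _
  have hevε : ∀ᶠ a : ℝ in atTop, K₁ + 1 ≤ a ^ (γ * (1 - 2 * K) - (1 - ρ)) :=
    (tendsto_rpow_atTop hε0).eventually_ge_atTop _
  obtain ⟨a, haA, haγ, haε⟩ := ((eventually_ge_atTop (max 1 (2 * (‖x₀‖ + δ)))).and (hevγ.and hevε)).exists
  have ha1 : 1 ≤ a := le_trans (le_max_left _ _) haA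
  have haR : 2 * (‖x₀‖ + δ) ≤ a := le_trans (le_max_right _ _) haA
  have ha0 : 0 < a := by linarith
  -- the usable window length `L_a`
  obtain ⟨La, hLa⟩ : ∃ La : ℝ, La = min (a ^ 2) ((c₁ * a) ^ e) := ⟨_, rfl⟩
  have hLa_sq : La ≤ a ^ 2 := by rw [hLa]; exact min_le_left _ _
  have hLa_e : La ≤ (c₁ * a) ^ e := by rw [hLa]; exact min_le_right _ _
  have hLa_ge : c₂ * a ^ γ ≤ La := by rw [hLa]; exact window_length_le ha1 hc₁0 hc₂1 hc₂c hγ2 hγe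
  have hLa_t₀ : 2 * (-t₀) ≤ La := by
    have h := (div_le_iff₀ hc₂0).1 haγ
    linarith
  have hLa0 : 0 < La := by linarith
  -- the floor on every slice of the usable window
  obtain ⟨F, hF⟩ : ∃ F : ℝ, F = w ^ 2 * Real.exp (-(2 * Λ₁)) * ((-t₀) / La) ^ (2 * K) := ⟨_, rfl⟩
  have hslice : ∀ t₁ ∈ Ioo (-La) t₀,
      ENNReal.ofReal (F * V) ≤
        ∫⁻ x in ball (0 : EuclideanSpace ℝ (Fin 3)) a, ENNReal.ofReal (‖curl (u t₁) x‖ ^ 2) := by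
    intro t₁ ht₁
    obtain ⟨T, hTm, hTsub, hTvol, hTfloor⟩ := hblob t₀ ht₀T x₀ δ w hδ hw0.le hball t₁ ht₁.2
    have ht₁La : -t₁ < La := by linarith [ht₁.1]
    have ht₁0 : 0 < -t₁ := by linarith [ht₁.2]
    have hle : -t₁ ≤ (c₁ * a) ^ (1 - κ)⁻¹ := by rw [← he]; exact le_trans ht₁La.le hLa_e
    have hdrift : M / (1 - κ) * ((-t₁) ^ (1 - κ) - (-t₀) ^ (1 - κ)) ≤ a / 4 :=
      drift_le_quarter hM0 h1κ hc₁ ha0 ht₁0.le (by linarith) hle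
    have hTa : T ⊆ ball (0 : EuclideanSpace ℝ (Fin 3)) a := hTsub.trans (ball_subset_ball (by linarith))
    -- the constant floor `F` is below the avatar's pointwise floor
    have hint : ∫ s in Set.Ioo t₁ t₀, Λ s ≤ Λ₁ := by
      rw [hΛ₁]
      exact setIntegral_mono_set hΛi (Eventually.of_forall fun s => hΛ0 s)
        (Eventually.of_forall (Ioo_subset_Iio_self.trans (Iio_subset_Iio ht₀T.le)))
    have hexp : Real.exp (-(2 * Λ₁)) ≤ Real.exp (-(2 * ∫ s in Set.Ioo t₁ t₀, Λ s)) :=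
      Real.exp_le_exp.2 (by linarith)
    have hratio : ((-t₀) / La) ^ (2 * K) ≤ ((-t₀) / (-t₁)) ^ (2 * K) :=
      Real.rpow_le_rpow (div_nonneg hnt₀.le hLa0.le) (div_le_div_of_nonneg_left hnt₀.le ht₁0 ht₁La.le) (by linarith)
    have hFle : ∀ x ∈ T, F ≤ ‖curl (u t₁) x‖ ^ 2 := by
      intro x hx
      refine le_trans ?_ (hTfloor x hx)
      rw [hF]
      have h1 : 0 ≤ w ^ 2 * Real.exp (-(2 * Λ₁)) := by positivity
      have h2 : 0 ≤ ((-t₀) / (-t₁)) ^ (2 * K) := Real.rpow_nonneg (div_nonneg hnt₀.le ht₁0.le) _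
      calc w ^ 2 * Real.exp (-(2 * Λ₁)) * ((-t₀) / La) ^ (2 * K)
          ≤ w ^ 2 * Real.exp (-(2 * Λ₁)) * ((-t₀) / (-t₁)) ^ (2 * K) := mul_le_mul_of_nonneg_left hratio h1
        _ ≤ w ^ 2 * Real.exp (-(2 * ∫ s in Set.Ioo t₁ t₀, Λ s)) * ((-t₀) / (-t₁)) ^ (2 * K) :=
            mul_le_mul_of_nonneg_right (mul_le_mul_of_nonneg_left hexp (sq_nonneg _)) h2
    have hF0 : 0 ≤ F := by
      rw [hF]; exact mul_nonneg (by positivity) (Real.rpow_nonneg (div_nonneg hnt₀.le hLa0.le) _)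
    calc ENNReal.ofReal (F * V) = ENNReal.ofReal F * volume T := by rw [ENNReal.ofReal_mul hF0, hVof, hTvol]
      _ = ∫⁻ _ in T, ENNReal.ofReal F := (setLIntegral_const _ _).symm
      _ ≤ ∫⁻ x in T, ENNReal.ofReal (‖curl (u t₁) x‖ ^ 2) :=
          setLIntegral_mono' hTm fun x hx => ENNReal.ofReal_le_ofReal (hFle x hx)
      _ ≤ ∫⁻ x in ball (0 : EuclideanSpace ℝ (Fin 3)) a, ENNReal.ofReal (‖curl (u t₁) x‖ ^ 2) :=
          lintegral_mono_set hTa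
  -- integrate over the usable window and compare with the budget
  have hFV0 : 0 ≤ F * V := by
    rw [hF]
    exact mul_nonneg (mul_nonneg (by positivity) (Real.rpow_nonneg (div_nonneg hnt₀.le hLa0.le) _)) hV0.le
  have hIoo : Ioo (-La) t₀ ⊆ Ioo (-a ^ 2) 0 := Ioo_subset_Ioo (by linarith) ht₀.le
  have hwin : ENNReal.ofReal (F * V * (t₀ - -La)) ≤ ENNReal.ofReal (16 * ((c : ℝ) * a ^ (1 - ρ))) := by
    calc ENNReal.ofReal (F * V * (t₀ - -La)) = ENNReal.ofReal (F * V) * ENNReal.ofReal (t₀ - -La) :=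
          ENNReal.ofReal_mul hFV0
      _ = ∫⁻ _ in Ioo (-La) t₀, ENNReal.ofReal (F * V) := by rw [setLIntegral_const, Real.volume_Ioo]
      _ ≤ ∫⁻ t₁ in Ioo (-La) t₀, ∫⁻ x in ball (0 : EuclideanSpace ℝ (Fin 3)) a, ENNReal.ofReal (‖curl (u t₁) x‖ ^ 2) :=
          setLIntegral_mono' measurableSet_Ioo hslice
      _ ≤ ∫⁻ t₁ in Ioo (-a ^ 2) 0, ∫⁻ x in ball (0 : EuclideanSpace ℝ (Fin 3)) a, ENNReal.ofReal (‖curl (u t₁) x‖ ^ 2) :=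
          lintegral_mono_set hIoo
      _ ≤ ENNReal.ofReal (16 * ((c : ℝ) * a ^ (1 - ρ))) := lintegral_window_sq_curl_le hH hcl hE ha0
  have hbudget : F * V * (t₀ + La) ≤ 16 * (c : ℝ) * a ^ (1 - ρ) := by
    have h := (ENNReal.ofReal_le_ofReal_iff (by positivity)).1 hwin
    have e1 : t₀ - -La = t₀ + La := by ring
    rw [e1] at h
    linarith
  -- rewrite the floor constant as `C₀ · L_a^{-2K}`
  have hFV : F * V = C₀ * La ^ (-(2 * K)) := by
    rw [hF, hC₀, Real.div_rpow (by linarith) hLa0.le, Real.rpow_neg hLa0.le]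
    ring
  rw [hFV] at hbudget
  -- the race
  have hfin := rpow_le_of_floor_budget ha0 hC₀0 hc₂0 h2K hLa0 hbudget hLa_t₀ hLa_ge
  rw [← hK₁] at hfin
  linarith

end Summit.NavierStokesRegularity.NavierStokesRegularity.Theorems.PowerGaugeEulerLiouville.StretchingBudget

end
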